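import Summits.QuantumAdvantage.QuantumAdvantage.Theses.CompactnessLift
import Summits.QuantumAdvantage.QuantumAdvantage.Theorems.CompactnessLiftCompactnessPrinciple
import Literature.Computability.QuantumComplexity.BQTime

/-!
# Route CompactnessLift · crux `LanguageLadder` (stmt-QuantumAdvantage-15271) — AS TYPED it is the
# summit in the quadratic-padding window (unconditional kernel certificate)

The route types the lower class of the ladder as the OPERATOR class `bp (DTIME (fun n => n ^ c))`;
in the tree's `bp` the coin string has length `p |x|` for an arbitrary polynomial `p` and the inner
`DTIME` machine is clocked on the padded pair `⟨x, y⟩`, so coins are free padding. With the sibling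
crux's padding collapse (`CompactnessLiftPadding.paddingCollapse : ∃ c₀, BPP ⊆ bp (DTIME (· ^ c₀))`,
landed for stmt-QuantumAdvantage-15270) every statement below is UNCONDITIONAL:

* `exists_bp_DTIME_pow_eq_BPP` — some rung class IS `BPP`;
* `quantumAdvantage_of_languageLadder` — **the typed crux implies the summit** (`closes` applied to
  the landed `compactnessPrinciple_proof`);
* `languageLadder_iff_not_BQTime_two_subset_BPP` — the crux is EXACTLY `¬ (BQTIME(n²) ⊆ BPP)`;
  `not_languageLadder_iff_BQTime_two_subset_BPP` — a refutation is exactly a full dequantization of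
  quadratic-time-uniform Clifford+T deciders;
* `languageLadder_iff_exists_forall` — the `∀ c` is decorative (one witness serves every exponent);
* `languageLadder_iff_quantumAdvantage_of_summitGivesLadder` — modulo the route's own support item
  `SummitGivesLadder` (stmt-15274, definitionally `QuantumAdvantage → LanguageLadder`) the crux is
  EQUIVALENT to the summit; `summitGivesLadder_iff` spells that item as quadratic padding of one
  `BQP ∖ BPP` witness.

So the item is hypothesis-type / summit-strength as filed (nine independent readings on the item,
now a theorem): no line of genuine lemmas can conclude it, and the intended statement is the repaired
ladder over honest `BPTime` (refuter rattack-15271: `∀ c, ∃ L ∈ BQTime (· ^ 2), L ∉ BPTime (· ^ c)`),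
which the typed crux implies (`Cruxes/LanguageLadder/Disproof.lean §6`) but not conversely.

References: S. Arora, B. Barak, *Computational Complexity: A Modern Approach*, CUP 2009,
Def. 7.2–7.3 (BPTIME / BPP via coin strings) [AroraBarakCC2009]; E. Bernstein, U. Vazirani,
*Quantum complexity theory*, SIAM J. Comput. 26 (1997), §8.1 (BQTime(T(n))) [BernsteinVazirani1997SICOMP].
-/

-- the `Summit.QuantumAdvantage.QuantumAdvantage.…` namespace repeats summit = sub-problem (D-0017 layout)
set_option linter.dupNamespace false

namespace Summit.QuantumAdvantage.QuantumAdvantage.Theorems.CompactnessLiftLanguageLadder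

open Literature.Computability.Complexity Literature.Computability.QuantumComplexity
  Literature.Computability.Cryptography
open Summit.QuantumAdvantage.QuantumAdvantage.Theses.CompactnessLift

/-- Reading of the crux: the route's inlined class `QuadQ` is `BQTime (fun n => n ^ 2)` verbatim
(`BQTime.lean`), the lower class is the operator class `bp (DTIME (· ^ c))`. [folklore] -/
theorem languageLadder_iff_forall_exists :
    LanguageLadder ↔ ∀ c : ℕ, ∃ L ∈ BQTime (fun n => n ^ 2), L ∉ bp (DTIME fun n => n ^ c) :=
  Iff.rfl

/-- Every rung class lies in `BPP` (`DTIME (· ^ c) ⊆ P` and `bp` is monotone). [folklore] -/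
theorem bp_DTIME_pow_subset_BPP (c : ℕ) : bp (DTIME fun n : ℕ => n ^ c) ⊆ BPP :=
  bp_mono fun _ hL => Set.mem_iUnion.2 ⟨c, hL⟩

/-- **Some rung class IS `BPP`**: with the padding collapse `BPP ⊆ bp (DTIME (· ^ c₀))`
(`CompactnessLiftPadding.paddingCollapse`) and `bp_DTIME_pow_subset_BPP`. [folklore] -/
theorem exists_bp_DTIME_pow_eq_BPP : ∃ c₀ : ℕ, bp (DTIME fun n : ℕ => n ^ c₀) = BPP := by
  obtain ⟨c₀, h⟩ := CompactnessLiftPadding.paddingCollapse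
  exact ⟨c₀, (bp_DTIME_pow_subset_BPP c₀).antisymm h⟩

/-- **The typed crux implies the summit, unconditionally**: the route's deciding theorem `closes`
applied to the landed `compactnessPrinciple_proof` (stmt-15270). So `LanguageLadder` as filed is at
least as strong as `QuantumAdvantage` itself. [folklore] -/
theorem quantumAdvantage_of_languageLadder (h : LanguageLadder) : _root_.QuantumAdvantage :=
  closes CompactnessLiftPadding.compactnessPrinciple_proof h

/-- **The typed crux is exactly `¬ (BQTIME(n²) ⊆ BPP)`** — the summit restricted to the
quadratic-time-uniform window. (→) at the exponent `c₀` of `exists_bp_DTIME_pow_eq_BPP` the rung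
class is `BPP`; (←) a witness outside `BPP` is outside every rung class. [folklore] -/
theorem languageLadder_iff_not_BQTime_two_subset_BPP :
    LanguageLadder ↔ ¬ (BQTime (fun n => n ^ 2) ⊆ BPP) := by
  constructor
  · intro h hsub
    obtain ⟨c₀, hc₀⟩ := exists_bp_DTIME_pow_eq_BPP
    obtain ⟨L, hL, hnot⟩ := h c₀
    exact hnot (hc₀.symm ▸ hsub hL)
  · intro h c
    by_contra hc
    push Not at hc
    exact h fun L hL => bp_DTIME_pow_subset_BPP c (hc L hL)

/-- **What a refutation of the typed crux is**: a full dequantization `BQTIME(n²) ⊆ BPP` of all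
quadratic-time-uniform Clifford+T deciders (the `¬ QuantumAdvantage` programme in the quadratic
window) — nothing weaker. [folklore] -/
theorem not_languageLadder_iff_BQTime_two_subset_BPP :
    ¬ LanguageLadder ↔ BQTime (fun n => n ^ 2) ⊆ BPP := by
  rw [languageLadder_iff_not_BQTime_two_subset_BPP, not_not]

/-- **The `∀ c` is decorative**: the ladder holds iff ONE quadratic-time-uniform quantum language lies
outside every rung class (quantifier swap for free). [folklore] -/
theorem languageLadder_iff_exists_forall :
    LanguageLadder ↔ ∃ L ∈ BQTime (fun n => n ^ 2), ∀ c : ℕ, L ∉ bp (DTIME fun n => n ^ c) := by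
  rw [languageLadder_iff_not_BQTime_two_subset_BPP, Set.not_subset]
  constructor
  · rintro ⟨L, hL, hB⟩
    exact ⟨L, hL, fun c hc => hB (bp_DTIME_pow_subset_BPP c hc)⟩
  · rintro ⟨L, hL, hc⟩
    obtain ⟨c₀, hc₀⟩ := exists_bp_DTIME_pow_eq_BPP
    exact ⟨L, hL, fun hB => hc c₀ (hc₀.symm ▸ hB)⟩

/-- The route's support item `SummitGivesLadder` (stmt-15274) is, verbatim, `QuantumAdvantage →
LanguageLadder`. [folklore] -/
theorem summitGivesLadder_iff_imp : SummitGivesLadder ↔ (_root_.QuantumAdvantage → LanguageLadder) :=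
  Iff.rfl

/-- … and hence says exactly: a `BQP` language outside `BPP` yields a `BQTIME(n²)` language outside
`BPP` (quadratic padding of one witness). [folklore] -/
theorem summitGivesLadder_iff :
    SummitGivesLadder ↔ (_root_.QuantumAdvantage → ¬ (BQTime (fun n => n ^ 2) ⊆ BPP)) :=
  imp_congr_right fun _ => languageLadder_iff_not_BQTime_two_subset_BPP

/-- **Modulo the route's own padding item the typed crux IS the summit**:
`SummitGivesLadder → (LanguageLadder ↔ QuantumAdvantage)`. [folklore] -/
theorem languageLadder_iff_quantumAdvantage_of_summitGivesLadder (h : SummitGivesLadder) :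
    LanguageLadder ↔ _root_.QuantumAdvantage :=
  ⟨quantumAdvantage_of_languageLadder, h⟩

end Summit.QuantumAdvantage.QuantumAdvantage.Theorems.CompactnessLiftLanguageLadder
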